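import Summits.AnomalousDissipation.AnomalousDissipation.Theorems.MomentParityDefs

/-!
# Route MomentParity · `GalerkinEnsembleRealization` — level-independent bounds for the Galerkin
  vector field in the energy ball

For the Fourier–Galerkin system of the Navier–Stokes equations (`galerkinRHS`, frequency set `S`)
the convection symbol of a *transversal* coefficient family is in divergence form,
`c_l · m = c_l · k` for `l + m = k`, so that in the energy ball `∑_{k∈S} ‖c k‖² ≤ R²` its `k`-th
coefficient is bounded by `2π |k| R²` **independently of `S`** (`norm_convectionCoeff_le_of_sum_sq_le`),
and the whole field by the constant `pathLip ν A R k` of `MomentParityDefs`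
(`norm_galerkinRHS_apply_le_pathLip`). These are the equicontinuity constants of the trajectory
space (stmt-AnomalousDissipation-11466).
-/

noncomputable section

set_option linter.dupNamespace false

open MeasureTheory Set Filter Topology Function
open scoped BigOperators

namespace Summit.AnomalousDissipation.AnomalousDissipation.Theorems.MomentParity

open Literature.Analysis.FunctionSpaces Literature.Analysis.FunctionSpaces.Torus
open Literature.Analysis.FluidPDE Literature.Analysis.FluidPDE.Torus

variable {d : Type*} [Fintype d]

/-! ### Cauchy–Schwarz for the amplitude `c · k` -/

/-- **The amplitude `c · k = ∑ⱼ cⱼ kⱼ` is at most `‖c‖ |k|`.** -/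
theorem norm_sum_mul_intCast_le (c : EuclideanSpace ℂ d) (k : d → ℤ) :
    ‖∑ j, c j * (k j : ℂ)‖ ≤ ‖c‖ * Real.sqrt (freqNormSq k) := by
  -- as an inner product with the complex vector of `k`
  set kC : EuclideanSpace ℂ d := WithLp.toLp 2 fun j => (k j : ℂ) with hkC
  have h1 : ∑ j, c j * (k j : ℂ) = inner ℂ (EuclideanSpace.conjVec c) kC := by
    rw [PiLp.inner_apply]
    refine Finset.sum_congr rfl fun j _ => ?_
    rw [EuclideanSpace.conjVec_apply]
    simp [hkC, mul_comm]
  have h2 : ‖kC‖ = Real.sqrt (freqNormSq k) := by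
    rw [EuclideanSpace.norm_eq, freqNormSq]
    congr 1
    refine Finset.sum_congr rfl fun j _ => ?_
    simp [hkC]
  rw [h1, ← EuclideanSpace.norm_conjVec c, ← h2]
  exact norm_inner_le_norm _ _

/-! ### The convection symbol in the energy ball -/

/-- **Divergence form**: for a transversal family and `l + m = k` with `l ∈ S`,
`c_l · m = c_l · k` (since `c_l · l = 0`). -/
theorem sum_mul_eq_of_isTransversal {S : Finset (d → ℤ)} {c : (d → ℤ) → EuclideanSpace ℂ d}
    (hc : IsTransversal S c) {l m k : d → ℤ} (hl : l ∈ S) (hlm : l + m = k) :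
    ∑ j, c l j * (m j : ℂ) = ∑ j, c l j * (k j : ℂ) := by
  have hm : m = k - l := by rw [← hlm]; abel
  subst hm
  have h0 : ∑ j, c l j * (l j : ℂ) = 0 := by
    have h := hc l hl
    rw [← h]
    exact Finset.sum_congr rfl fun j _ => mul_comm _ _
  simp only [Pi.sub_apply, Int.cast_sub, mul_sub, Finset.sum_sub_distrib, h0, sub_zero]

/-- **Level-independent bound for the convection symbol**: for `c` transversal on `S` with
`∑_{k∈S} ‖c̄ k‖² ≤ R²` (bar = extension by zero), `‖(c̄ ⋆ c̄)_k‖ ≤ 2π |k| R²` for every `k`. -/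
theorem norm_convectionCoeff_le_of_sum_sq_le [DecidableEq d] {S : Finset (d → ℤ)}
    {c : ↥S → EuclideanSpace ℂ d} (hc : IsSolenoidalCoeff c) {R : ℝ}
    (hR : ∑ k ∈ S, ‖coeffExt S c k‖ ^ 2 ≤ R ^ 2) (k : d → ℤ) :
    ‖convectionCoeff S (coeffExt S c) (coeffExt S c) k‖ ≤
      2 * Real.pi * Real.sqrt (freqNormSq k) * R ^ 2 := by
  have hT : IsTransversal S (coeffExt S c) := hc.isTransversal_coeffExt
  rw [convectionCoeff_def]
  -- collapse the inner sum to `m = k - l`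
  have hinner : ∀ l ∈ S, ∑ m ∈ S, (if l + m = k then
      (2 * Real.pi * Complex.I * ∑ j, coeffExt S c l j * (m j : ℂ)) • coeffExt S c m else 0) =
      (2 * Real.pi * Complex.I * ∑ j, coeffExt S c l j * (k j : ℂ)) • coeffExt S c (k - l) := by
    intro l hl
    have h1 : ∀ m ∈ S, (if l + m = k then
        (2 * Real.pi * Complex.I * ∑ j, coeffExt S c l j * (m j : ℂ)) • coeffExt S c m else 0) =
        if k - l = m then (2 * Real.pi * Complex.I * ∑ j, coeffExt S c l j * (k j : ℂ)) • coeffExt S c m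
          else 0 := by
      intro m _
      by_cases h : l + m = k
      · rw [if_pos h, if_pos (by rw [← h]; abel), sum_mul_eq_of_isTransversal hT hl h]
      · rw [if_neg h, if_neg (fun h' => h (by rw [← h']; abel))]
    rw [Finset.sum_congr rfl h1, Finset.sum_ite_eq]
    split_ifs with hkl
    · rfl
    · rw [coeffExt_of_not_mem _ hkl, smul_zero]
  rw [Finset.sum_congr rfl hinner]
  -- termwise bound `2π |k| ‖c̄ l‖ ‖c̄ (k-l)‖`
  have hterm : ∀ l ∈ S, ‖(2 * Real.pi * Complex.I * ∑ j, coeffExt S c l j * (k j : ℂ)) • coeffExt S c (k - l)‖ ≤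
      2 * Real.pi * Real.sqrt (freqNormSq k) * (‖coeffExt S c l‖ * ‖coeffExt S c (k - l)‖) := by
    intro l _
    rw [norm_smul, norm_mul, norm_mul, norm_mul, Complex.norm_I, mul_one, Complex.norm_real,
      Real.norm_of_nonneg Real.pi_pos.le, Complex.norm_ofNat]
    have h := norm_sum_mul_intCast_le (coeffExt S c l) k
    have h2 : 0 ≤ ‖coeffExt S c (k - l)‖ := norm_nonneg _
    calc 2 * Real.pi * ‖∑ j, coeffExt S c l j * (k j : ℂ)‖ * ‖coeffExt S c (k - l)‖
        ≤ 2 * Real.pi * (‖coeffExt S c l‖ * Real.sqrt (freqNormSq k)) * ‖coeffExt S c (k - l)‖ := by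
          gcongr
      _ = _ := by ring
  refine (norm_sum_le _ _).trans ((Finset.sum_le_sum hterm).trans ?_)
  rw [← Finset.mul_sum]
  refine mul_le_mul_of_nonneg_left ?_ (by positivity)
  -- Cauchy–Schwarz and the reindexing `l ↦ k - l`
  have hCS := Finset.sum_mul_sq_le_sq_mul_sq S (fun l => ‖coeffExt S c l‖) fun l => ‖coeffExt S c (k - l)‖
  have hshift : ∑ l ∈ S, ‖coeffExt S c (k - l)‖ ^ 2 ≤ ∑ m ∈ S, ‖coeffExt S c m‖ ^ 2 := by
    have hinj : Set.InjOn (fun l => k - l) (S : Set (d → ℤ)) := fun a _ b _ h => by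
      simpa using h
    rw [← Finset.sum_image (g := fun l => k - l) (f := fun m => ‖coeffExt S c m‖ ^ 2) hinj]
    have hzero : ∀ m ∈ S.image (fun l => k - l), m ∉ S → ‖coeffExt S c m‖ ^ 2 = 0 := fun m _ hmS => by
      rw [coeffExt_of_not_mem _ hmS, norm_zero, zero_pow two_ne_zero]
    calc ∑ m ∈ S.image (fun l => k - l), ‖coeffExt S c m‖ ^ 2
        = ∑ m ∈ (S.image (fun l => k - l)).filter (· ∈ S), ‖coeffExt S c m‖ ^ 2 := by
          rw [Finset.sum_filter]
          refine Finset.sum_congr rfl fun m hm => ?_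
          by_cases hmS : m ∈ S
          · rw [if_pos hmS]
          · rw [if_neg hmS, hzero m hm hmS]
      _ ≤ ∑ m ∈ S, ‖coeffExt S c m‖ ^ 2 :=
          Finset.sum_le_sum_of_subset_of_nonneg (fun m hm => (Finset.mem_filter.1 hm).2)
            fun _ _ _ => sq_nonneg _
  have hA : ∑ l ∈ S, ‖coeffExt S c l‖ ^ 2 ≤ R ^ 2 := hR
  have hB : ∑ l ∈ S, ‖coeffExt S c (k - l)‖ ^ 2 ≤ R ^ 2 := hshift.trans hR
  have hnn : 0 ≤ ∑ l ∈ S, ‖coeffExt S c l‖ * ‖coeffExt S c (k - l)‖ :=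
    Finset.sum_nonneg fun l _ => mul_nonneg (norm_nonneg _) (norm_nonneg _)
  nlinarith [hCS, hA, hB, Finset.sum_nonneg fun l (_ : l ∈ S) => sq_nonneg ‖coeffExt S c l‖,
    Finset.sum_nonneg fun l (_ : l ∈ S) => sq_nonneg ‖coeffExt S c (k - l)‖]

/-! ### The Galerkin field in the energy ball -/

/-- A single coefficient is bounded by `|R|` in the energy ball. -/
theorem norm_coeffExt_le_of_sum_sq_le [DecidableEq d] {S : Finset (d → ℤ)} {c : ↥S → EuclideanSpace ℂ d}
    {R : ℝ} (hR : ∑ k ∈ S, ‖coeffExt S c k‖ ^ 2 ≤ R ^ 2) (k : d → ℤ) : ‖coeffExt S c k‖ ≤ |R| := by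
  by_cases hk : k ∈ S
  · have h1 : ‖coeffExt S c k‖ ^ 2 ≤ R ^ 2 :=
      (Finset.single_le_sum (f := fun k => ‖coeffExt S c k‖ ^ 2) (fun _ _ => sq_nonneg _) hk).trans hR
    have h' : ‖coeffExt S c k‖ ^ 2 ≤ |R| ^ 2 := by rwa [sq_abs]
    exact le_abs_self _ |>.trans (abs_le_of_sq_le_sq h' (abs_nonneg R))
  · rw [coeffExt_of_not_mem _ hk, norm_zero]; exact abs_nonneg R

/-- **The Galerkin vector field is bounded by `pathLip` in the energy ball**: for `c` in the
Galerkin phase space with `∑_{k∈S} ‖c̄ k‖² ≤ R²` and force coefficients `‖ḡ k‖ ≤ A`,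
`‖galerkinRHS(g, c) k‖ ≤ pathLip ν A R k` for every `k ∈ S`. -/
theorem norm_galerkinRHS_apply_le_pathLip [DecidableEq d] {S : Finset (d → ℤ)} (ν : ℝ)
    {g c : ↥S → EuclideanSpace ℂ d} (hc : c ∈ galerkinSubspace S) {R A : ℝ}
    (hR : ∑ k ∈ S, ‖coeffExt S c k‖ ^ 2 ≤ R ^ 2) (hA : ∀ k, ‖coeffExt S g k‖ ≤ A) (k : ↥S) :
    ‖galerkinRHS S ν g c k‖ ≤ pathLip ν A R (k : d → ℤ) := by
  rw [galerkinRHS_apply, galerkinField_def, pathLip]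
  have h1 : ‖-((((ν * (4 * Real.pi ^ 2 * freqNormSq (k : d → ℤ))) : ℝ) : ℂ) • coeffExt S c k)‖ ≤
      |ν| * (4 * Real.pi ^ 2 * freqNormSq (k : d → ℤ)) * |R| := by
    have h4 : (0:ℝ) ≤ 4 * Real.pi ^ 2 * freqNormSq (k : d → ℤ) :=
      mul_nonneg (by positivity) (freqNormSq_nonneg _)
    rw [norm_neg, norm_smul, Complex.norm_real, Real.norm_eq_abs, abs_mul, abs_of_nonneg h4]
    exact mul_le_mul_of_nonneg_left (norm_coeffExt_le_of_sum_sq_le hR k) (mul_nonneg (abs_nonneg _) h4)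
  have h2 : ‖leraySym (k : d → ℤ) (coeffExt S g k - convectionCoeff S (coeffExt S c) (coeffExt S c) k)‖ ≤
      A + 2 * Real.pi * Real.sqrt (freqNormSq (k : d → ℤ)) * R ^ 2 :=
    (norm_leraySym_le _ _).trans ((norm_sub_le _ _).trans
      (add_le_add (hA k) (norm_convectionCoeff_le_of_sum_sq_le hc.2 hR k)))
  linarith [norm_add_le (-((((ν * (4 * Real.pi ^ 2 * freqNormSq (k : d → ℤ))) : ℝ) : ℂ) • coeffExt S c k))
    (leraySym (k : d → ℤ) (coeffExt S g k - convectionCoeff S (coeffExt S c) (coeffExt S c) k)), h1, h2]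

/-- The Lipschitz constants are at least `1` for `A ≥ 0`. -/
theorem one_le_pathLip {ν A R : ℝ} (hA : 0 ≤ A) (k : d → ℤ) : 1 ≤ pathLip ν A R k := by
  unfold pathLip
  have : 0 ≤ |ν| * (4 * Real.pi ^ 2 * freqNormSq k) * |R| :=
    mul_nonneg (mul_nonneg (abs_nonneg _) (mul_nonneg (by positivity) (freqNormSq_nonneg _))) (abs_nonneg _)
  have : 0 ≤ 2 * Real.pi * Real.sqrt (freqNormSq k) * R ^ 2 := by positivity
  linarith

end Summit.AnomalousDissipation.AnomalousDissipation.Theorems.MomentParity
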